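import Literature.NumberTheory.PAdicHodge.AinfDivisionTowerNilpotence
import Literature.NumberTheory.PAdicHodge.AinfEvalPtTruncationNil
import Literature.NumberTheory.PAdicHodge.BmaxPlusTheta
import Literature.RingTheory.FormalGroups.PadicLogTypeSeriesAdd
import HarnessLib

/-!
# The `A_max`-period map `[ũ] ↦ Λ_N(ι[ũ]) = p^N·log_W(ι[ũ])` on Fontaine's integrals: additivity, `Γ_F`-equivariance, and `θ = 0` on torsion sequences

Topic `Literature/NumberTheory/PAdicHodge`; namespace `Literature.NumberTheory.PAdicHodge.AinfTop`. THEOREMS ONLY (no definition, no named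
fact, no instance, no `sorry`). Companion of `BmaxPlusFormalLogDivisionTower` (the `[p]`-division tower and the exact Dieudonné–Honda relation):
the remaining structure of the periods `Λ_N(ι[ũ], z) ∈ A_max = B_max⁺(F)` (`PadicLogSeries.logSum`, numerators `b`, `ι : 𝔸_inf → B⁰_max = 𝔸_inf[ξ/p]`)
of Fontaine's integrals `[ũ] = divisionLiftPt W hθ u ∈ Ŵ(𝔫)` of `[p]_W`-division sequences `u` of points of `Ŵ(𝔪_{ℂ_F})`:

* §1 `algebraMap_addW_sub_aeval_mem_pow` — the chord–tangent truncation estimate `coe_addW_sub_aeval_truncTotal_mem_pow_div` TRANSPORTED to `B⁰_max`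
  (`(p, ξ)ʲ ↦ pʲ`; `B⁰_max` read as a `ℤ`-algebra through `Ring.toIntAlgebra`, as the generic `PadicLogSeries` files do);
* §2 ★ `logSum_divisionLiftPt_addSeq` — **ADDITIVITY `Λ_N(ι[u ⊕ u′]) = Λ_N(ι[ũ]) + Λ_N(ι[ũ′])`** for deep base points (`‖u₀‖^N, ‖u′₀‖^N ≤ ‖p‖`;
  `[u ⊕ u′] = [ũ] + [ũ′]`, `divisionLiftPt_addSeq`, and `PadicLogSeries.logSum_eq_add_of_forall_sub_aeval_mem'`);
* §3 ★ `galBmaxPlus_logSum_divisionLiftPt` — **`Γ_F`-EQUIVARIANCE `σ(Λ_N(ι[ũ], z)) = Λ_N(ι[σu], σz)`** (`σ[ũ] = [σu]`, `gal_torsionLift`; `σ` fixes `ℤ_p`,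
  `galAinf_zpToAinf`; naturality `PadicLogSeries.adicCompletionMap_logSum`) — for ALL numerators `b` and witnesses `z`;
* §4 ★ `thetaBmaxPlus_logSum_eq_zero` — `θ(Λ_N(y, z)) = 0` whenever `θ(y) = 0` (then `θ(z) = 0` too, and every term carries `y` or `z`); hence
  `thetaBmaxPlus_logSum_divisionLiftPt_eq_zero` — **`θ(Λ_N(ι[ũ])) = 0` for TORSION sequences** (`u₀ = 0`, i.e. `u ∈ T_pŴ`; `θ[ũ] = u₀`), and
  `thetaBmaxPlus_det_eq_zero` — the Legendre determinant `D = Λ·φΛ′ − φΛ·Λ′` of two torsion sequences lies in `ker θ` (with `φD = pD` from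
  `BmaxPlusFormalLogDivisionTower.frobBmaxPlus_det_logSum_divisionLiftPt`: `D ∈ (A_max)^{φ=p} ∩ ker θ`, the input of Fontaine's lemma).

So `T_pŴ(𝒪_{ℂ_F}) → A_max`, `a ↦ L_a := Λ_1(ι[ã])`, is additive and `Γ_F`-equivariant with values in `ker θ` — the period map of brick (M)/B4 of the φ-road of
line `kato_lever` (crux K★ `stmt-BirchSwinnertonDyer-22226`, memo `Summits/…/Cruxes/StarredOptimalManinUnitFiveSeven/Lines/kato-lever-K2-phi-road.md`).
Infrastructure only; BSD / K★ are not proved by any of this.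

## References
* P. Colmez, *Périodes p-adiques des variétés abéliennes*, Math. Ann. 292 (1992), §2. [Colmez1992PeriodesAbeliennes]
* J.-M. Fontaine, *Le corps des périodes p-adiques*, Astérisque 223 (1994), Exp. II §1.2.2, §1.3, §1.5. [FontaineAsterisque223III]
* J. H. Silverman, *The Arithmetic of Elliptic Curves* (2009), IV.2.3, IV.5.2. [SilvermanAEC2009]
-/

noncomputable section

open Ideal WittVector MvPowerSeries ValuativeRel Field Finset

namespace Literature.NumberTheory.PAdicHodge

namespace AinfTop

open Literature.NumberTheory.GaloisRepresentations Literature.NumberTheory.GaloisRepresentations.IsNonarchimedeanLocalField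
open Literature.NumberTheory.GaloisRepresentations.LubinTate Literature.NumberTheory.EllipticCurves
open Literature.RingTheory.FormalGroups Literature.AlgebraicGeometry.Resolution
open MvPowerSeries (truncTotal)

variable {F : Type} [Field F] [ValuativeRel F] [TopologicalSpace F] [IsNonarchimedeanLocalField F]
  [CharZero F] {p : ℕ} [Fact p.Prime] [Fact (¬ IsUnit (p : integerC F))]
  [IsAdicComplete (Ideal.span {(p : integerC F)}) (integerC F)]
  {hθ : Function.Surjective (fontaineTheta (integerC F) p)} (W : WeierstrassCurve ℤ)

/-! ## §1 The chord–tangent truncation estimate in `B⁰_max` -/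

omit [CharZero F] [IsAdicComplete (Ideal.span {(p : integerC F)}) (integerC F)] in
/-- `(p, ξ)ʲ𝔸_inf ↦ pʲ·B⁰_max` under `𝔸_inf → B⁰_max` (local copy of `BmaxPlusFormalLogDivisionTower.algebraMap_mem_span_pow_of_mem_pow`).
[cite: FontaineAsterisque223III, Exp. II §1.3] -/
private theorem algebraMap_mem_span_pow_of_mem_pow' {j : ℕ} {a : AinfTop F p} (ha : a ∈ (WithIdeal.i : Ideal (AinfTop F p)) ^ j) :
    algebraMap (Ainf (p := p) F) (bmaxZero F p) ((AinfTop.of F p).symm a) ∈ Ideal.span {(p : bmaxZero F p)} ^ j := by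
  have hmap : (Ideal.span {(p : Ainf (p := p) F), xi}).map (algebraMap (Ainf (p := p) F) (bmaxZero F p)) ≤
      Ideal.span {(p : bmaxZero F p)} :=
    Ideal.map_le_iff_le_comap.2 fun b hb => algebraMap_mem_span_of_mem_span_p_xi hb
  have ha' : (AinfTop.of F p).symm a ∈ (Ideal.span {(p : Ainf (p := p) F), xi}) ^ j := ha
  have h := Ideal.mem_map_of_mem (algebraMap (Ainf (p := p) F) (bmaxZero F p)) ha'
  rw [Ideal.map_pow] at h
  exact Ideal.pow_right_mono hmap j h

/-- ★ **The chord–tangent truncation estimate in `B⁰_max`**: for `a, b ∈ Ŵ(𝔫)` with `a^N, b^N ∈ (p, ξ)` and `(N + N)·m ≤ D`,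
`ι(a ⊕_W b) − (F_W)_{≤D}(ι a, ι b) ∈ p^m B⁰_max` (`coe_addW_sub_aeval_truncTotal_mem_pow_div`, transported along `ι : 𝔸_inf → B⁰_max`, `(p, ξ) ↦ (p)`; the
polynomial is evaluated in the `ℤ`-algebra structure `Ring.toIntAlgebra` of `B⁰_max`, as in the generic `PadicLogSeries` files). This is the hypothesis
`hg`/`hstep` of `PadicLogSeries.logSum_eq_add_of_forall_sub_aeval_mem'` / `logSum_eq_nsmul_of_tower`. [cite: FontaineAsterisque223III, Exp. II §1.3]
[cite: SilvermanAEC2009, IV.2.3] -/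
theorem algebraMap_addW_sub_aeval_mem_pow (a b : (nilTheta F p hθ).toIdeal) {N : ℕ}
    (ha : ((a : AinfTop F p)) ^ N ∈ (WithIdeal.i : Ideal (AinfTop F p))) (hb : ((b : AinfTop F p)) ^ N ∈ (WithIdeal.i : Ideal (AinfTop F p)))
    {m D : ℕ} (hD : (N + N) * m ≤ D) :
    algebraMap (Ainf (p := p) F) (bmaxZero F p) ((AinfTop.of F p).symm ((addW W a b : (nilTheta F p hθ).toIdeal) : AinfTop F p)) -
      @MvPolynomial.aeval ℤ (bmaxZero F p) (Fin 2) _ _ (Ring.toIntAlgebra _)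
        (![algebraMap (Ainf (p := p) F) (bmaxZero F p) ((AinfTop.of F p).symm (a : AinfTop F p)),
          algebraMap (Ainf (p := p) F) (bmaxZero F p) ((AinfTop.of F p).symm (b : AinfTop F p))] : Fin 2 → bmaxZero F p)
        (truncTotal (D + 1) W.formalGroupLaw) ∈ Ideal.span {(p : bmaxZero F p)} ^ m := by
  let gT : AinfTop F p →+* bmaxZero F p := (algebraMap (Ainf (p := p) F) (bmaxZero F p)).comp (AinfTop.of F p).symm.toRingHom
  have h1 := coe_addW_sub_aeval_truncTotal_mem_pow_div (hθ := hθ) W a b ha hb D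
  have hle : m ≤ (D + 1) / (N + N) := by
    rcases Nat.eq_zero_or_pos (N + N) with h0 | hpos
    · rcases Nat.eq_zero_or_pos m with rfl | hm
      · exact Nat.zero_le _
      · -- `N = 0` would give `a^0 = 1 ∈ (p, ξ)`, which is false (`one_not_mem_span_p_xi`)
        have hN0 : N = 0 := by omega
        rw [hN0, pow_zero] at ha
        have htop : (WithIdeal.i : Ideal (AinfTop F p)) = ⊤ := (Ideal.eq_top_iff_one _).2 ha
        exact absurd htop (by
          intro h
          have h1' : (1 : Ainf (p := p) F) ∈ Ideal.span {(p : Ainf (p := p) F), xi} := by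
            have : (1 : AinfTop F p) ∈ (WithIdeal.i : Ideal (AinfTop F p)) := by rw [h]; exact Submodule.mem_top
            exact this
          exact one_not_mem_span_p_xi (F := F) (p := p) h1')
    · exact (Nat.le_div_iff_mul_le hpos).2 (by nlinarith)
  have h2 := algebraMap_mem_span_pow_of_mem_pow' (F := F) (p := p) (Ideal.pow_le_pow_right hle h1)
  have hfun : (fun i => gT (((![a, b] : Fin 2 → (nilTheta F p hθ).toIdeal) i : (nilTheta F p hθ).toIdeal) : AinfTop F p)) =
      (![algebraMap (Ainf (p := p) F) (bmaxZero F p) ((AinfTop.of F p).symm (a : AinfTop F p)),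
        algebraMap (Ainf (p := p) F) (bmaxZero F p) ((AinfTop.of F p).symm (b : AinfTop F p))] : Fin 2 → bmaxZero F p) := by
    funext i; fin_cases i <;> rfl
  have e : algebraMap (Ainf (p := p) F) (bmaxZero F p) ((AinfTop.of F p).symm
      (((addW W a b : (nilTheta F p hθ).toIdeal) : AinfTop F p) -
        MvPolynomial.aeval (fun i => (((![a, b] : Fin 2 → (nilTheta F p hθ).toIdeal) i : (nilTheta F p hθ).toIdeal) : AinfTop F p))
          (truncTotal (D + 1) W.formalGroupLaw))) =
      algebraMap (Ainf (p := p) F) (bmaxZero F p) ((AinfTop.of F p).symm ((addW W a b : (nilTheta F p hθ).toIdeal) : AinfTop F p)) -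
        @MvPolynomial.aeval ℤ (bmaxZero F p) (Fin 2) _ _ (Ring.toIntAlgebra _)
          (![algebraMap (Ainf (p := p) F) (bmaxZero F p) ((AinfTop.of F p).symm (a : AinfTop F p)),
            algebraMap (Ainf (p := p) F) (bmaxZero F p) ((AinfTop.of F p).symm (b : AinfTop F p))] : Fin 2 → bmaxZero F p)
          (truncTotal (D + 1) W.formalGroupLaw) := by
    show gT (_ - _) = gT _ - _
    rw [map_sub]
    congr 1
    rw [MvPolynomial.map_aeval, ← hfun]
    exact MvPolynomial.eval₂Hom_congr (f₂ := @algebraMap ℤ (bmaxZero F p) _ _ (Ring.toIntAlgebra _)) (RingHom.ext_int _ _) rfl rfl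
  rw [e] at h2
  exact h2

/-! ## §2 Additivity: `Λ_N(ι[u ⊕ u′]) = Λ_N(ι[ũ]) + Λ_N(ι[ũ′])` -/

set_option maxHeartbeats 1600000 in
/-- ★ **ADDITIVITY of the `A_max`-periods.** Let `u, u′` be `[p]_W`-division sequences of points of `Ŵ(𝔪_{ℂ_F})` with deep base points
(`‖u₀‖^N, ‖u′₀‖^N ≤ ‖p‖`, `N ≥ 1`), `u ⊕ u′` their termwise chord–tangent sum (`addSeq`, again a division sequence), and `z, z′, z″` witnesses of the
`p`-nilpotence of `ι[ũ], ι[ũ′], ι[u ⊕ u′]` of index `N` in `B⁰_max`. Then for the `p`-adic sums with numerators `formalLogNum W p` (`Λ_N = p^N·log_W`):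
**`Λ_N(ι[u ⊕ u′], z″) = Λ_N(ι[ũ], z) + Λ_N(ι[ũ′], z′)`** in `A_max` — `[u ⊕ u′] = [ũ] + [ũ′]` in `Ŵ(𝔫)` (`divisionLiftPt_addSeq`), the sum being the
`(p, ξ)`-adic value of `F_W` (`algebraMap_addW_sub_aeval_mem_pow`), and `log_W(F_W(X, Y)) = log_W X + log_W Y`
(`PadicLogSeries.logSum_eq_add_of_forall_sub_aeval_mem'`). [cite: Colmez1992PeriodesAbeliennes, §2] [cite: SilvermanAEC2009, IV.5.2] -/
theorem logSum_divisionLiftPt_addSeq {u u' : ℕ → (maxNilIdealC F).toIdeal} (hup : ∀ n, mulPC F p W (u (n + 1)) = u n)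
    (hup' : ∀ n, mulPC F p W (u' (n + 1)) = u' n) {N : ℕ} (hN : 1 ≤ N)
    (huN : ‖(((u 0 : (maxNilIdealC F).toIdeal) : CBall F) : CompletedAlgClosure F)‖ ^ N ≤ ‖(p : CompletedAlgClosure F)‖)
    (huN' : ‖(((u' 0 : (maxNilIdealC F).toIdeal) : CBall F) : CompletedAlgClosure F)‖ ^ N ≤ ‖(p : CompletedAlgClosure F)‖)
    {z z' z'' : bmaxZero F p}
    (hz : algebraMap (Ainf (p := p) F) (bmaxZero F p)
        ((AinfTop.of F p).symm (((divisionLiftPt W hθ u hup).val : (nilTheta F p hθ).toIdeal) : AinfTop F p)) ^ N =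
      (p : bmaxZero F p) * z)
    (hz' : algebraMap (Ainf (p := p) F) (bmaxZero F p)
        ((AinfTop.of F p).symm (((divisionLiftPt W hθ u' hup').val : (nilTheta F p hθ).toIdeal) : AinfTop F p)) ^ N =
      (p : bmaxZero F p) * z')
    (hz'' : algebraMap (Ainf (p := p) F) (bmaxZero F p)
        ((AinfTop.of F p).symm (((divisionLiftPt W hθ (addSeq F W u u') (mulPC_addSeq W hup hup')).val : (nilTheta F p hθ).toIdeal) :
          AinfTop F p)) ^ N =
      (p : bmaxZero F p) * z'') :
    PadicLogSeries.logSum ((algebraMap (Ainf (p := p) F) (bmaxZero F p)).comp zpToAinf) (GaloisContinuity.formalLogNum W p) N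
        (algebraMap (Ainf (p := p) F) (bmaxZero F p)
          ((AinfTop.of F p).symm (((divisionLiftPt W hθ (addSeq F W u u') (mulPC_addSeq W hup hup')).val : (nilTheta F p hθ).toIdeal) :
            AinfTop F p))) z'' =
      PadicLogSeries.logSum ((algebraMap (Ainf (p := p) F) (bmaxZero F p)).comp zpToAinf) (GaloisContinuity.formalLogNum W p) N
          (algebraMap (Ainf (p := p) F) (bmaxZero F p)
            ((AinfTop.of F p).symm (((divisionLiftPt W hθ u hup).val : (nilTheta F p hθ).toIdeal) : AinfTop F p))) z +
        PadicLogSeries.logSum ((algebraMap (Ainf (p := p) F) (bmaxZero F p)).comp zpToAinf) (GaloisContinuity.formalLogNum W p) N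
          (algebraMap (Ainf (p := p) F) (bmaxZero F p)
            ((AinfTop.of F p).symm (((divisionLiftPt W hθ u' hup').val : (nilTheta F p hθ).toIdeal) : AinfTop F p))) z' := by
  haveI := isDomain_bmaxZero (F := F) (p := p)
  haveI := charZero_bmaxZero (F := F) (p := p)
  have ha : ((((divisionLiftPt W hθ u hup).val : (nilTheta F p hθ).toIdeal) : AinfTop F p)) ^ N ∈ (WithIdeal.i : Ideal (AinfTop F p)) := by
    simpa only [one_nsmul] using pow_coe_val_nsmul_divisionLiftPt_mem W (hθ := hθ) hup huN 1
  have hb : ((((divisionLiftPt W hθ u' hup').val : (nilTheta F p hθ).toIdeal) : AinfTop F p)) ^ N ∈ (WithIdeal.i : Ideal (AinfTop F p)) := by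
    simpa only [one_nsmul] using pow_coe_val_nsmul_divisionLiftPt_mem W (hθ := hθ) hup' huN' 1
  rw [divisionLiftPt_addSeq W hup hup', val_add_N] at hz'' ⊢
  have hyz : ∀ i : Fin 2,
      (![algebraMap (Ainf (p := p) F) (bmaxZero F p)
            ((AinfTop.of F p).symm (((divisionLiftPt W hθ u hup).val : (nilTheta F p hθ).toIdeal) : AinfTop F p)),
          algebraMap (Ainf (p := p) F) (bmaxZero F p)
            ((AinfTop.of F p).symm (((divisionLiftPt W hθ u' hup').val : (nilTheta F p hθ).toIdeal) : AinfTop F p))] : Fin 2 → bmaxZero F p) i ^ N =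
        (p : bmaxZero F p) * (![z, z'] : Fin 2 → bmaxZero F p) i := by
    intro i; fin_cases i
    · exact hz
    · exact hz'
  have h := PadicLogSeries.logSum_eq_add_of_forall_sub_aeval_mem' ((algebraMap (Ainf (p := p) F) (bmaxZero F p)).comp zpToAinf)
    (GaloisContinuity.formalLogNum W p) (W.map (Int.castRingHom ℚ)).formalLog
    (algebraMap_formalLogNum_eq W ((algebraMap (Ainf (p := p) F) (bmaxZero F p)).comp zpToAinf))
    W.constantCoeff_formalGroupLaw (GaloisContinuity.formalLog_subst_map_formalGroupLaw W) hN hyz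
    (fun k => ⟨(N + N) * k, fun D hD => algebraMap_addW_sub_aeval_mem_pow W _ _ ha hb hD⟩) hz''
  simpa only [Matrix.cons_val_zero, Matrix.cons_val_one] using h

/-! ## §3 `Γ_F`-equivariance: `σ(Λ_N(ι[ũ], z)) = Λ_N(ι[σu], σz)` -/

omit [CharZero F] [IsAdicComplete (Ideal.span {(p : integerC F)}) (integerC F)] in
/-- `σ` on `B⁰_max` extends `σ` on `𝔸_inf`. [folklore] -/
private theorem galBmaxZero_algebraMap' [CharZero F] [IsAdicComplete (Ideal.span {(p : integerC F)}) (integerC F)]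
    (σ : absoluteGaloisGroup F) (x : Ainf (p := p) F) :
    galBmaxZero σ (algebraMap (Ainf (p := p) F) (bmaxZero F p) x) = algebraMap (Ainf (p := p) F) (bmaxZero F p) (galAinf σ x) :=
  Subtype.ext (galAinfLoc_algebraMap σ x)

/-- `σ` on `B⁰_max` fixes `ℤ_p → 𝔸_inf → B⁰_max`. [cite: FontaineAsterisque223III, Exp. II §1.2] -/
theorem galBmaxZero_comp_algebraMap_comp_zpToAinf (σ : absoluteGaloisGroup F) :
    (galBmaxZero (p := p) (F := F) σ).comp ((algebraMap (Ainf (p := p) F) (bmaxZero F p)).comp zpToAinf) =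
      (algebraMap (Ainf (p := p) F) (bmaxZero F p)).comp zpToAinf := by
  refine RingHom.ext fun c => ?_
  simp only [RingHom.comp_apply]
  rw [galBmaxZero_algebraMap', galAinf_zpToAinf]

set_option maxHeartbeats 1600000 in
/-- ★ **`Γ_F`-EQUIVARIANCE of the `A_max`-periods**: for every `σ ∈ Γ_F`, numerators `b`, index `N` and `z ∈ B⁰_max`,
**`σ(Λ_N(ι[ũ], z)) = Λ_N(ι[σu], σz)`**, where `σu` is the termwise Galois translate (again a `[p]`-division sequence, `mulPC_galSeq`) and
`[σu] = σ[ũ]` (`gal_torsionLift`): naturality of the `p`-adic sums along the ring endomorphism `σ` of `B⁰_max` (`PadicLogSeries.adicCompletionMap_logSum`),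
which fixes `ℤ_p`. [cite: FontaineAsterisque223III, Exp. II §1.2, §1.5] [cite: Colmez1992PeriodesAbeliennes, §2] -/
theorem galBmaxPlus_logSum_divisionLiftPt (b : ℕ → ℤ_[p]) (σ : absoluteGaloisGroup F) {u : ℕ → (maxNilIdealC F).toIdeal}
    (hup : ∀ n, mulPC F p W (u (n + 1)) = u n) (N : ℕ) (z : bmaxZero F p) :
    galBmaxPlus σ (PadicLogSeries.logSum ((algebraMap (Ainf (p := p) F) (bmaxZero F p)).comp zpToAinf) b N
        (algebraMap (Ainf (p := p) F) (bmaxZero F p)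
          ((AinfTop.of F p).symm (((divisionLiftPt W hθ u hup).val : (nilTheta F p hθ).toIdeal) : AinfTop F p))) z) =
      PadicLogSeries.logSum ((algebraMap (Ainf (p := p) F) (bmaxZero F p)).comp zpToAinf) b N
        (algebraMap (Ainf (p := p) F) (bmaxZero F p)
          ((AinfTop.of F p).symm (((divisionLiftPt W hθ (galSeq F σ u) (mulPC_galSeq W hθ σ hup)).val : (nilTheta F p hθ).toIdeal) :
            AinfTop F p))) (galBmaxZero σ z) := by
  have h := PadicLogSeries.adicCompletionMap_logSum ((algebraMap (Ainf (p := p) F) (bmaxZero F p)).comp zpToAinf) b N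
    (algebraMap (Ainf (p := p) F) (bmaxZero F p)
      ((AinfTop.of F p).symm (((divisionLiftPt W hθ u hup).val : (nilTheta F p hθ).toIdeal) : AinfTop F p))) z (galBmaxZero σ)
  rw [galBmaxZero_comp_algebraMap_comp_zpToAinf, galBmaxZero_algebraMap'] at h
  have hval : galAinf σ ((AinfTop.of F p).symm (((divisionLiftPt W hθ u hup).val : (nilTheta F p hθ).toIdeal) : AinfTop F p)) =
      (AinfTop.of F p).symm (((divisionLiftPt W hθ (galSeq F σ u) (mulPC_galSeq W hθ σ hup)).val : (nilTheta F p hθ).toIdeal) :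
        AinfTop F p) := by
    rw [coe_val_divisionLiftPt, coe_val_divisionLiftPt, ← gal_torsionLift W σ hup]
    rfl
  rw [hval] at h
  exact h

/-! ## §4 `θ(Λ) = 0` on torsion sequences, and on Legendre determinants -/

omit [CharZero F] [IsAdicComplete (Ideal.span {(p : integerC F)}) (integerC F)] in
/-- `θ⁰(T_m) = 0` for every term of `Λ_N(y, z)` when `θ⁰(y) = θ⁰(z) = 0` (`m ≥ 1`: the term carries `z^{m/N}·y^{m % N}` with
`m/N ≥ 1` or `m % N ≥ 1`). [cite: Colmez1992PeriodesAbeliennes, §2] -/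
private theorem thetaBmaxZero_term_eq_zero [CharZero F] [IsAdicComplete (Ideal.span {(p : integerC F)}) (integerC F)]
    (ι : ℤ_[p] →+* bmaxZero F p) (b : ℕ → ℤ_[p]) (N : ℕ) {y z : bmaxZero F p}
    (hy : thetaBmaxZero F p y = 0) (hz : thetaBmaxZero F p z = 0) {m : ℕ} (hm : m ≠ 0) :
    thetaBmaxZero F p (PadicLogSeries.term ι b N y z m) = 0 := by
  rw [PadicLogSeries.term, map_mul, map_mul, map_pow, map_pow, hy, hz]
  rcases Nat.eq_zero_or_pos (m / N) with hq | hq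
  · have hr : m % N ≠ 0 := by
      intro hr
      have := Nat.div_add_mod m N
      rw [hq, hr, mul_zero, add_zero] at this
      exact hm this.symm
    rw [zero_pow hr, mul_zero]
  · rw [zero_pow (Nat.pos_iff_ne_zero.1 hq), mul_zero, zero_mul]

set_option maxHeartbeats 1600000 in
/-- ★ **`θ(Λ_N(y, z)) = 0` when `θ⁰(y) = 0`** (`y ∈ B⁰_max`, `y^N = p·z`, `N ≥ 1`): then `p·θ⁰(z) = θ⁰(y)^N = 0`, so `θ⁰(z) = 0`, every term of every
partial sum dies under `θ⁰`, and `θ` is `p`-adically continuous (`thetaBmaxPlus_eq_zero_of_forall`). [cite: Colmez1992PeriodesAbeliennes, §2]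
[cite: FontaineAsterisque223III, Exp. II §1.5] -/
theorem thetaBmaxPlus_logSum_eq_zero (ι : ℤ_[p] →+* bmaxZero F p) (b : ℕ → ℤ_[p]) {N : ℕ} (hN : 1 ≤ N) {y z : bmaxZero F p}
    (hyz : y ^ N = (p : bmaxZero F p) * z) (hy : thetaBmaxZero F p y = 0) :
    thetaBmaxPlus F p (PadicLogSeries.logSum ι b N y z) = 0 := by
  have hz : thetaBmaxZero F p z = 0 := by
    have h := congrArg (thetaBmaxZero F p) hyz
    rw [map_pow, hy, zero_pow (by omega), map_mul, thetaBmaxZero_natCast] at h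
    exact (mul_eq_zero.1 h.symm).resolve_left (natCast_integerC_ne_zero (F := F) (Fact.out : p.Prime).ne_zero)
  refine thetaBmaxPlus_eq_zero_of_forall (fun n => PadicLogSeries.partialSum ι b N y z (2 * n * N))
    (fun n => PadicLogSeries.evalₐ_logSum ι b y z hN n) fun n => ?_
  rw [PadicLogSeries.partialSum, map_sum]
  exact Finset.sum_eq_zero fun m _ => thetaBmaxZero_term_eq_zero ι b N hy hz (Nat.succ_ne_zero m)

/-- **`θ⁰(ι[ũ]) = 0` for a TORSION sequence** (`u₀ = 0`): `θ[ũ] = u₀` (`thetaPt_divisionLiftPt`). [cite: FontaineAsterisque223III, Exp. II §1.2.2] -/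
theorem thetaBmaxZero_algebraMap_divisionLiftPt_eq_zero {u : ℕ → (maxNilIdealC F).toIdeal} (hup : ∀ n, mulPC F p W (u (n + 1)) = u n)
    (hu₀ : (((u 0 : (maxNilIdealC F).toIdeal) : CBall F) : CompletedAlgClosure F) = 0) :
    thetaBmaxZero F p (algebraMap (Ainf (p := p) F) (bmaxZero F p)
      ((AinfTop.of F p).symm (((divisionLiftPt W hθ u hup).val : (nilTheta F p hθ).toIdeal) : AinfTop F p))) = 0 := by
  rw [thetaBmaxZero_algebraMap]
  have h1 : ((theta F p (((divisionLiftPt W hθ u hup).val : (nilTheta F p hθ).toIdeal) : AinfTop F p) : CBall F) : CompletedAlgClosure F) = 0 := by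
    rw [← coe_val_thetaPt, thetaPt_divisionLiftPt]; exact hu₀
  apply Subtype.ext
  rw [← coe_theta]
  simpa using h1

set_option maxHeartbeats 1600000 in
/-- ★ **`θ(Λ_N(ι[ũ], z)) = 0` for every TORSION sequence `u`** (`u₀ = 0`, i.e. `u ∈ T_pŴ(𝒪_{ℂ_F})`; any numerators `b`, `N ≥ 1`, any witness): the
`A_max`-periods of the Tate module lie in `ker θ`. [cite: Colmez1992PeriodesAbeliennes, §2] [cite: FontaineAsterisque223III, Exp. II §1.5] -/
theorem thetaBmaxPlus_logSum_divisionLiftPt_eq_zero (b : ℕ → ℤ_[p]) {u : ℕ → (maxNilIdealC F).toIdeal}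
    (hup : ∀ n, mulPC F p W (u (n + 1)) = u n) (hu₀ : (((u 0 : (maxNilIdealC F).toIdeal) : CBall F) : CompletedAlgClosure F) = 0)
    {N : ℕ} (hN : 1 ≤ N) {z : bmaxZero F p}
    (hz : algebraMap (Ainf (p := p) F) (bmaxZero F p)
        ((AinfTop.of F p).symm (((divisionLiftPt W hθ u hup).val : (nilTheta F p hθ).toIdeal) : AinfTop F p)) ^ N =
      (p : bmaxZero F p) * z) :
    thetaBmaxPlus F p (PadicLogSeries.logSum ((algebraMap (Ainf (p := p) F) (bmaxZero F p)).comp zpToAinf) b N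
        (algebraMap (Ainf (p := p) F) (bmaxZero F p)
          ((AinfTop.of F p).symm (((divisionLiftPt W hθ u hup).val : (nilTheta F p hθ).toIdeal) : AinfTop F p))) z) = 0 :=
  thetaBmaxPlus_logSum_eq_zero _ b hN hz (thetaBmaxZero_algebraMap_divisionLiftPt_eq_zero W hup hu₀)

omit [CharZero F] [IsAdicComplete (Ideal.span {(p : integerC F)}) (integerC F)] in
/-- **The Legendre determinant of two `θ`-kernel periods lies in `ker θ`**: `θ(Λ) = θ(Λ′) = 0 ⟹ θ(Λ·φΛ′ − φΛ·Λ′) = 0` (any endomorphism `φ`). With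
`φD = pD` (`BmaxPlusFormalLogDivisionTower.frobBmaxPlus_det_logSum_divisionLiftPt`) the determinant of two Tate-module periods lies in
`(A_max)^{φ=p} ∩ ker θ` — the input of Fontaine's lemma (`BmaxPlusFontaineKernel`). [cite: FontaineAsterisque223III, Exp. II §1.5] -/
theorem thetaBmaxPlus_det_eq_zero [CharZero F] [IsAdicComplete (Ideal.span {(p : integerC F)}) (integerC F)]
    (φ : BmaxPlus F p →+* BmaxPlus F p) {Λ Λ' : BmaxPlus F p}
    (h : thetaBmaxPlus F p Λ = 0) (h' : thetaBmaxPlus F p Λ' = 0) :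
    thetaBmaxPlus F p (Λ * φ Λ' - φ Λ * Λ') = 0 := by
  rw [map_sub, map_mul, map_mul, h, h', zero_mul, mul_zero, sub_zero]

end AinfTop

end Literature.NumberTheory.PAdicHodge

end
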